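/-
Copyright (c) 2026 the pub-hodgecm-mathlib formalisation cell (harness21).  Prover seat hodgecm-mathlib-LH7-p01 (g8): N8-INNER ROAD B, E3a slice «hIT» (the block-transport reading),
carved by the E3a pen LH7-p04 (g8) 2026-09-02T17:29:12Z under the road owner LH2-plan (g1).
-/
import Literature.NumberTheory.Automorphic.ArchInnerTwistPlaceTransportBlock    -- ★ (IT)-3 p852235 LH7-p04: `blockReading_innerTwist`, `measurePreserving_cosetCongr_innerTwist`; brings (IT)-1∕2, ★ `cosetCongr`, `quotientMeasure`
import Literature.NumberTheory.Rogawski1990.ArchEPAssemblyDefiniteSwap           -- ★ (s1) p852258 LH3-p03: the `α`-side summand's tokens (`archPiEquivCM`, `MeasurableEquiv.piEquivPiSubtypeProd`, `descConj`); brings ★ E2a, ★ (A1)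
import HarnessLib

/-!
# EP ASSEMBLY, the `hIT` reading: the `β`-side `I`-block reading of the coupling factor EQUALS the `α`-side `I`-block reading of the `U(3)^D`-average (Rogawski 1990 §8.2, §14.2;
# Folland §2.6 (2.52); Deitmar–Echterhoff Thm. 1.5.3)

Topic `NumberTheory/Rogawski1990`; namespace `Literature.NumberTheory.Rogawski1990`.  THEOREMS ONLY (no `def`, no instance, no notation, no axiom, no named fact, no `sorry`);
kernel lane `--kind proof --supports stmt-HodgeConjecture-24833`.  Cell `pub/hodgecm-mathlib`, crux H413 (`stmt-HodgeConjecture-24833`); HCML «GO 500» road N8-INNER ROAD B «EP road»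
(owner∕dealer LH2-plan (g1)), brick (12′) «EP ASSEMBLY = H-S4′», file E3a (pen LH7-p04 (g8), CENSUS-E3a v1.1 `F0/P3c/LH7/LH7-p04/g8/e3a/CENSUS-E3a.v1.LH7p04g8.md` §3∕§4), slice **hIT**
= the block-transport reading of ★ E3-CORE p852223 `stableSumG_eq_inv_pow_mul_of_readings`:
`hIT : (∏ v, r v) ≠ 0 → ∀ ρ₂ ∈ partnerPerms (S.subtype (¬ p ·)), Rβ ρ₂ = Rα ρ₂`, where `Rβ ρ₂` is the last factor of the hβ slice (F0P2-p02 (g21), sigsheet a5220a5f: the `¬p`-block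
quotient reading of the coupling factor `G z` at the `β`-frame, `z` the frozen `D`-classes) and `Rα ρ₂` is the summand of ★ (s1) p852258 `sum_partnerPerms_chartOrbG_eq_card_mul_sum_integral_quotient_integral_group`
(the `¬p`-block quotient reading of the `U(3)^D`-AVERAGE of `a′` at the `α`-frame, `D`-integral INSIDE).  Frame-generic (`α`, `β`, label `S`, block `p`); E3a reads it at `β₀`, `p := (· ∈ D)`.
HONEST LABEL: count-neutral; HC_CM is proved only modulo the 7 printed citations (2 remaining: hLiu418 = stmt-HodgeConjecture-24832, h413 = stmt-HodgeConjecture-24833) until rung 0 closes.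

§1 **`blockReading_coupling_eq_average`** — (T1) THE TRANSPORT: if, read through the place isomorphisms `ι_{w′}` (★ (IT)-1) on the `α`-side `¬p`-block, the coupling `G z` IS the
`U(3)^D`-average of `a′` at the `D`-chart point `γ_D(c_D)` — `G z (ι_I y) = ∫_{Π_p U(α)_w} a′ (e_α⁻¹ ((g γ_w(c_D w) g⁻¹)_p, y)) d⊗ν′_w` for every `α`-side block `y` (hypothesis `hG`; discharged
on the multiplier ball by the Glaeser agreement of the local class germ, §2 of the hIT sigsheet) — then `Rβ[G z; c_I] = Rα[a′; c_D, c_I]`: ★ (IT)-3 `blockReading_innerTwist` (`U := G z`,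
`v := Subtype.val`) with its one-place hypothesis `hmp` discharged by ★ `measurePreserving_cosetCongr_innerTwist` (torus images `t′ = (ι|_{T′})⁎ t`, `νβ_w = ι⁎ ν′_w`), then `hG`
pointwise under the `α`-side quotient integral.  The `¬p`-block coordinates enter as TWO names `cIβ = cIα` (a propositional equality, so that the consumer never rewrites under the
`descConj` binders: hβ writes `fun i => c w′.1 (ρ₂ w′ i)`, (s1) writes `slotPerm ρ′ c w′.1`).

## References
* [Rogawski1990] J. D. Rogawski, *Automorphic Representations of Unitary Groups in Three Variables*, Ann. of Math. Stud. 123 (1990), §8.2 p. 122 (orbital integrals place by place), §14.2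
  (14.2.1) pp. 232–233 (the inner transfer of `C_c^∞` functions).
* [Folland1995] G. B. Folland, *A Course in Abstract Harmonic Analysis* (1995), §2.6 (2.52) (change of variables along a group isomorphism), §2.2 (product measures).
* [DeitmarEchterhoff2014] A. Deitmar, S. Echterhoff, *Principles of Harmonic Analysis*, 2nd ed. (2014), Thm. 1.5.3 (naturality of the invariant quotient measure).
* [Shelstad1979] D. Shelstad, *Characters and inner forms of a quasi-split group over ℝ*, Compositio Math. 39 (1979), §4 pp. 22–26 (transfer between inner forms, place by place).
-/

set_option autoImplicit false

noncomputable section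

open MeasureTheory MeasureTheory.Measure NumberField NumberField.InfinitePlace Matrix Complex Topology
open Literature.MeasureTheory.Group Literature.NumberTheory.Automorphic Literature.NumberTheory.Automorphic.UnitaryGroup Literature.NumberTheory.Automorphic.ArchCartan
open scoped MatrixGroups Matrix Classical ENNReal NNReal

namespace Literature.NumberTheory.Rogawski1990

/-! ## §1 The transport -/

section Transport

variable (L : Type) [Field L] [NumberField L] [IsCMField L] (α β : Fin 3 → L) (S : Finset {w : InfinitePlace L // IsComplex w})
  /- TWO-FRAME HYGIENE (measured 2026-09-02, hIT census §3): with `∀ w`-FAMILIES of MEASURE-CLASS instances (`IsHaarMeasure`, `IsMulRightInvariant`, `IsInvInvariant`, …) for BOTH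
  frames in the instance context, every such goal of the OLDER frame makes typeclass resolution unify `U(β)_?w =?= U(α)_w` through lazy delta-unfolding of `archLocal`∕`Subgroup.toGroup`
  — > 6·10⁶ heartbeats for ONE `quotientMeasure` family term.  `MeasurableSpace`∕`BorelSpace`∕`LocallyCompactSpace`∕`SecondCountableTopology` families are harmless.  RECIPE used
  here (and recommended to E3a): keep the `β`-frame measure facts OUT of the instance context — an `And`-package `hβm` — and feed them by term-mode `haveI` under the place binder. -/
  -- the `β`-frame: σ-algebras and topology as instance families (harmless), measures as plain families + the `And`-package of their Haar properties
  [∀ w : {w : InfinitePlace L // IsComplex w}, MeasurableSpace ↥(archLocal L 3 (Matrix.diagonal β) w)]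
  [∀ w : {w : InfinitePlace L // IsComplex w}, BorelSpace ↥(archLocal L 3 (Matrix.diagonal β) w)]
  [∀ w : {w : InfinitePlace L // IsComplex w}, LocallyCompactSpace ↥(archLocal L 3 (Matrix.diagonal β) w)]
  [∀ w : {w : InfinitePlace L // IsComplex w}, SecondCountableTopology ↥(archLocal L 3 (Matrix.diagonal β) w)]
  [∀ w : {w : InfinitePlace L // IsComplex w}, MeasurableSpace (↥(archLocal L 3 (Matrix.diagonal β) w) ⧸ chartTorusGLoc L β w S)]
  [∀ w : {w : InfinitePlace L // IsComplex w}, BorelSpace (↥(archLocal L 3 (Matrix.diagonal β) w) ⧸ chartTorusGLoc L β w S)]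
  (νβw : ∀ w : {w : InfinitePlace L // IsComplex w}, Measure ↥(archLocal L 3 (Matrix.diagonal β) w))
  (t' : ∀ w : {w : InfinitePlace L // IsComplex w}, Measure ↥(chartTorusGLoc L β w S))
  -- the block: ANY decidable predicate (E3a: `p := (· ∈ D)`, the `α`-definite places); the `Fintype` instances of the two index subtypes are BINDERS (★ (F2)'s convention)
  (p : {w : InfinitePlace L // IsComplex w} → Prop) [DecidablePred p]
  [Fintype {w : {w : InfinitePlace L // IsComplex w} // p w}] [Fintype {w : {w : InfinitePlace L // IsComplex w} // ¬ p w}]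
  (hβm : ∀ w' : {w : {w : InfinitePlace L // IsComplex w} // ¬ p w}, (t' w'.1).IsHaarMeasure ∧ (t' w'.1).IsInvInvariant ∧ (νβw w'.1).IsHaarMeasure ∧ (νβw w'.1).IsMulRightInvariant)
  -- the `α`-frame: ★ (s1)∕(F2)'s section conventions verbatim (instance families; `locallyCompactSpace_archLocal_three` etc. supplied by the consumer with `haveI`)
  [∀ w : {w : InfinitePlace L // IsComplex w}, MeasurableSpace ↥(archLocal L 3 (Matrix.diagonal α) w)]
  [∀ w : {w : InfinitePlace L // IsComplex w}, BorelSpace ↥(archLocal L 3 (Matrix.diagonal α) w)]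
  [∀ w : {w : InfinitePlace L // IsComplex w}, LocallyCompactSpace ↥(archLocal L 3 (Matrix.diagonal α) w)]
  [∀ w : {w : InfinitePlace L // IsComplex w}, SecondCountableTopology ↥(archLocal L 3 (Matrix.diagonal α) w)]
  [∀ w : {w : InfinitePlace L // IsComplex w}, MeasurableSpace (↥(archLocal L 3 (Matrix.diagonal α) w) ⧸ chartTorusGLoc L α w S)]
  [∀ w : {w : InfinitePlace L // IsComplex w}, BorelSpace (↥(archLocal L 3 (Matrix.diagonal α) w) ⧸ chartTorusGLoc L α w S)]
  (ν'w : ∀ w : {w : InfinitePlace L // IsComplex w}, Measure ↥(archLocal L 3 (Matrix.diagonal α) w)) [∀ w, (ν'w w).IsHaarMeasure] [∀ w, (ν'w w).IsMulRightInvariant]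
  (t : ∀ w : {w : InfinitePlace L // IsComplex w}, Measure ↥(chartTorusGLoc L α w S)) [∀ w, (t w).IsHaarMeasure] [∀ w, (t w).IsInvInvariant]
  -- the place isomorphisms on the `¬p`-block (★ (IT)-1 `exists_continuousMulEquiv_archLocal_innerTwist`) and the image measures (free names + defining hypotheses)
  (ι : ∀ w' : {w : {w : InfinitePlace L // IsComplex w} // ¬ p w}, ↥(archLocal L 3 (Matrix.diagonal α) w'.1) ≃ₜ* ↥(archLocal L 3 (Matrix.diagonal β) w'.1))
  (hι : ∀ (w' : {w : {w : InfinitePlace L // IsComplex w} // ¬ p w}) (S' : Finset {w : InfinitePlace L // IsComplex w}) (cw : Fin 3 → ℝ),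
    ι w' (gprimeBlockAt L α w'.1 S' cw) = gprimeBlockAt L β w'.1 S' cw)
  (ht' : ∀ w' : {w : {w : InfinitePlace L // IsComplex w} // ¬ p w}, t' w'.1 = (t w'.1).map
    (ContinuousMulEquiv.restrictSubgroup (ι w') (chartTorusGLoc L α w'.1 S) (chartTorusGLoc L β w'.1 S) (fun g => (innerTwist_mem_chartTorusGLoc_iff L α β w'.1 (ι w') (hι w') S g).symm)))
  (hνβ : ∀ w' : {w : {w : InfinitePlace L // IsComplex w} // ¬ p w}, νβw w'.1 = (ν'w w'.1).map (ι w'))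

include hνβ ht' hβm in
/-- **(T1) THE `hIT` TRANSPORT.**  Let `G z` be the coupling factor of the per-ball test function at the frozen `D`-classes `z` (hβ's currency: second argument = the `¬p`-block of `β`-side
place components), `a′` the `α`-side test function, `c_D` the `D`-block chart coordinates and `cIβ = cIα` the `¬p`-block coordinates (two names, one propositional equality).  IF, read through
the place isomorphisms `ι_{w′}`, the coupling is the `U(3)^D`-AVERAGE of `a′` at `γ_D(c_D)` — `hG : G z (ι_I y) = ∫_{Π_p U(α)_w} a′ (e_α⁻¹ ((g_w γ^α_w(c_D w) g_w⁻¹)_p, y)) d⊗_p ν′_w` for every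
`α`-side block `y` — THEN the `β`-side `¬p`-block quotient reading of `G z` (box constants `t′_w(B′_β)`, quotient measures `νβ_w ∕ t′_w`) EQUALS the `α`-side `¬p`-block quotient reading of the
average (box constants `t_w(B′_α)`, quotient measures `ν′_w ∕ t_w`; the summand of ★ (s1)): `Rβ ρ₂ = Rα ρ₂` of ★ E3-CORE's `hIT`.  Proof: ★ (IT)-3 `blockReading_innerTwist` with `U := G z` (its
`hmp` from ★ `measurePreserving_cosetCongr_innerTwist` at each `w′`), then `hG` under the integral. [cite: Rogawski1990, §8.2 p. 122; §14.2 (14.2.1) p. 232] [cite: Folland1995, §2.6 (2.52)]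
[cite: DeitmarEchterhoff2014, Thm. 1.5.3] [cite: Shelstad1979, §4 p. 24] -/
theorem blockReading_coupling_eq_average (cD : {w : {w : InfinitePlace L // IsComplex w} // p w} → Fin 3 → ℝ)
    (cIβ cIα : {w : {w : InfinitePlace L // IsComplex w} // ¬ p w} → Fin 3 → ℝ) (hcI : cIβ = cIα)
    (a' : ↥(arch (↥(maximalRealSubfield L)) L (IsCMField.complexConj L) 3 (Matrix.diagonal α)) → ℂ)
    (G : ({w : {w : InfinitePlace L // IsComplex w} // p w} → ℂ × ℂ × ℂ) →
      (∀ w' : {w : {w : InfinitePlace L // IsComplex w} // ¬ p w}, ↥(archLocal L 3 (Matrix.diagonal β) w'.1)) → ℂ)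
    (z : {w : {w : InfinitePlace L // IsComplex w} // p w} → ℂ × ℂ × ℂ)
    (hG : ∀ y : (∀ w' : {w : {w : InfinitePlace L // IsComplex w} // ¬ p w}, ↥(archLocal L 3 (Matrix.diagonal α) w'.1)),
      G z (fun w' => ι w' (y w')) =
        ∫ g : (∀ w : {w : {w : InfinitePlace L // IsComplex w} // p w}, ↥(archLocal L 3 (Matrix.diagonal α) w.1)),
          a' ((archPiEquivCM 3 L (Matrix.diagonal α)).symm
            ((MeasurableEquiv.piEquivPiSubtypeProd (fun w : {w : InfinitePlace L // IsComplex w} => ↥(archLocal L 3 (Matrix.diagonal α) w)) p).symm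
              (fun w => g w * gprimeBlockAt L α w.1 S (cD w) * (g w)⁻¹, y)))
          ∂(Measure.pi fun w : {w : {w : InfinitePlace L // IsComplex w} // p w} => ν'w w.1)) :
    (∏ w' : {w : {w : InfinitePlace L // IsComplex w} // ¬ p w}, ((t' w'.1 (chartBoxImgGLoc L β w'.1 S)).toReal : ℂ)) *
        ∫ b' : (∀ w' : {w : {w : InfinitePlace L // IsComplex w} // ¬ p w}, ↥(archLocal L 3 (Matrix.diagonal β) w'.1) ⧸ chartTorusGLoc L β w'.1 S),
          G z (fun w' => descConj (gprimeBlockAt L β w'.1 S (cIβ w')) (chartTorusGLoc L β w'.1 S) (forall_mem_chartTorusGLoc_comm L β w'.1 S (cIβ w')) id (b' w'))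
          ∂(Measure.pi fun w' : {w : {w : InfinitePlace L // IsComplex w} // ¬ p w} =>
              haveI := (hβm w').1; haveI := (hβm w').2.1; haveI := (hβm w').2.2.1; haveI := (hβm w').2.2.2
              quotientMeasure (chartTorusGLoc L β w'.1 S) (t' w'.1) (isClosed_chartTorusGLoc L β w'.1 S) (νβw w'.1)) =
      (∏ w' : {w : {w : InfinitePlace L // IsComplex w} // ¬ p w}, ((t w'.1 (chartBoxImgGLoc L α w'.1 S)).toReal : ℂ)) *
        ∫ b : (∀ w' : {w : {w : InfinitePlace L // IsComplex w} // ¬ p w}, ↥(archLocal L 3 (Matrix.diagonal α) w'.1) ⧸ chartTorusGLoc L α w'.1 S),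
          (∫ g : (∀ w : {w : {w : InfinitePlace L // IsComplex w} // p w}, ↥(archLocal L 3 (Matrix.diagonal α) w.1)),
            a' ((archPiEquivCM 3 L (Matrix.diagonal α)).symm
              ((MeasurableEquiv.piEquivPiSubtypeProd (fun w : {w : InfinitePlace L // IsComplex w} => ↥(archLocal L 3 (Matrix.diagonal α) w)) p).symm
                (fun w => g w * gprimeBlockAt L α w.1 S (cD w) * (g w)⁻¹,
                  fun w' => descConj (gprimeBlockAt L α w'.1 S (cIα w')) (chartTorusGLoc L α w'.1 S)
                    (forall_mem_chartTorusGLoc_comm L α w'.1 S (cIα w')) id (b w'))))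
            ∂(Measure.pi fun w : {w : {w : InfinitePlace L // IsComplex w} // p w} => ν'w w.1))
          ∂(Measure.pi fun w' : {w : {w : InfinitePlace L // IsComplex w} // ¬ p w} =>
              quotientMeasure (chartTorusGLoc L α w'.1 S) (t w'.1) (isClosed_chartTorusGLoc L α w'.1 S) (ν'w w'.1)) := by
  subst hcI
  haveI : ∀ w : {w : InfinitePlace L // IsComplex w}, IsClosed (chartTorusGLoc L β w S : Set ↥(archLocal L 3 (Matrix.diagonal β) w)) :=
    fun w => isClosed_chartTorusGLoc L β w S
  haveI : ∀ w : {w : InfinitePlace L // IsComplex w}, SecondCountableTopology (↥(archLocal L 3 (Matrix.diagonal β) w) ⧸ chartTorusGLoc L β w S) := fun w => inferInstance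
  -- the one-place quotient-measure transport (B-1) at every place of the block (the `β`-frame Haar facts enter POINTWISE, by `haveI`, from the package)
  have hmp : ∀ w' : {w : {w : InfinitePlace L // IsComplex w} // ¬ p w}, MeasurePreserving
      (cosetCongr (ι w').toMulEquiv (chartTorusGLoc L α w'.1 S) (chartTorusGLoc L β w'.1 S) (fun g => innerTwist_mem_chartTorusGLoc_iff L α β w'.1 (ι w') (hι w') S g))
      (quotientMeasure (chartTorusGLoc L α w'.1 S) (t w'.1) (isClosed_chartTorusGLoc L α w'.1 S) (ν'w w'.1))
      (haveI := (hβm w').1; haveI := (hβm w').2.1; haveI := (hβm w').2.2.1; haveI := (hβm w').2.2.2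
       quotientMeasure (chartTorusGLoc L β w'.1 S) (t' w'.1) (isClosed_chartTorusGLoc L β w'.1 S) (νβw w'.1)) := fun w' => by
    haveI := (hβm w').1; haveI := (hβm w').2.1; haveI := (hβm w').2.2.1; haveI := (hβm w').2.2.2
    exact measurePreserving_cosetCongr_innerTwist L α β w'.1 S (ι w') (hι w') (t w'.1) (t' w'.1) (ht' w') (ν'w w'.1) (νβw w'.1) (hνβ w')
  haveI : ∀ w' : {w : {w : InfinitePlace L // IsComplex w} // ¬ p w},
      SigmaFinite (haveI := (hβm w').1; haveI := (hβm w').2.1; haveI := (hβm w').2.2.1; haveI := (hβm w').2.2.2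
        quotientMeasure (chartTorusGLoc L β w'.1 S) (t' w'.1) (isClosed_chartTorusGLoc L β w'.1 S) (νβw w'.1)) := fun w' => by
    haveI := (hβm w').1; haveI := (hβm w').2.1; haveI := (hβm w').2.2.1; haveI := (hβm w').2.2.2
    infer_instance
  have h := blockReading_innerTwist L α β S (fun w' : {w : {w : InfinitePlace L // IsComplex w} // ¬ p w} => (w'.1 : {w : InfinitePlace L // IsComplex w})) ι hι
    (fun w' => t w'.1) (fun w' => t' w'.1) ht'
    (fun w' => quotientMeasure (chartTorusGLoc L α w'.1 S) (t w'.1) (isClosed_chartTorusGLoc L α w'.1 S) (ν'w w'.1))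
    (fun w' => haveI := (hβm w').1; haveI := (hβm w').2.1; haveI := (hβm w').2.2.1; haveI := (hβm w').2.2.2
      quotientMeasure (chartTorusGLoc L β w'.1 S) (t' w'.1) (isClosed_chartTorusGLoc L β w'.1 S) (νβw w'.1)) hmp cIβ (G z)
  refine h.trans ?_
  congr 1
  refine integral_congr_ae (Filter.Eventually.of_forall fun b => ?_)
  exact hG _

end Transport

end Literature.NumberTheory.Rogawski1990
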